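import Literature.NumberTheory.Automorphic.ReciprocityGLn
import Literature.NumberTheory.Automorphic.Sweep1PotentialModularity
import HarnessLib

/-!
# Potential modularity of elliptic curves over CM fields in weight zero (lang.S28): the printed
# statement of Allen et al. behind `Literature.NumberTheory.Automorphic.potentiallyModular_ellipticCurve_CM`

Topic `NumberTheory/Automorphic`; sibling and *reduction* file of
`Literature.NumberTheory.Automorphic.ReciprocityGLn` for its named fact
`Literature.NumberTheory.Automorphic.potentiallyModular_ellipticCurve_CM` (**lang.S28**, formulation on Borel–Jacquet data
`CuspidalAutomorphicRepData` with Clozel's `HasWeightZero`), landed by the tenured seat of that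
fact. **This file carries no named fact** (review of the split, 2026-08-15, D-0026 / D-0027 A7):
its former named fact `exists_isCMField_isAutomorphicOfWeightZero` — the printed Cor. 7.1.12 for
`R_E` in weight `0`, a decomposition child of `potentiallyModular_ellipticCurve_CM` carrying the
*whole* difficulty of its parent (the parent follows from it by ten lines of coefficient
comparison, and it is even slightly stronger) — has been merged back into the parent's proof
obligation: the statement survives (verbatim, minus the printed "Galois", which the reduction does
not use) as the explicit hypothesis of the reduction theorem
`potentiallyModular_ellipticCurve_CM_of_isAutomorphicOfWeightZero`, so the accepted lang.S28 is
again the single unit of debt for Thm. 1.0.1 of the source in this language. Source: P. B. Allen,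
F. Calegari, A. Caraiani, T. Gee, D. Helm, B. V. Le Hung, J. Newton, P. Scholze, R. Taylor,
J. A. Thorne, *Potential automorphy over CM fields*, Ann. of Math. (2) 197 (2023), 897–1113
[ACCGHLNSTT2023], read in the held copy `lit:arxiv-1812.09999` (the text of the Annals version).
Theorem numbers below are those of the published paper, as already used by the
sibling decomposition `Sweep1PotentialModularity` of the *other* accepted formulation
`Literature.NumberTheory.Automorphic.exists_isCMField_isModular` of lang.S28; in the sequential numbering of the held text
they are: Thm. 7.1.11 = "Theorem 140" (label `mainthm`, p. 101), Cor. 7.1.12 = "Corollary 141"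
(p. 102), Cor. 7.1.13 = "Corollary 142" (`maincor`), Cor. 7.1.14 = "Corollary 143"
(`cor:satotate`), Thms. 6.1.1/6.1.2 = "Theorem 71/72" (§6.1, p. 64), Prop. 6.5.13 =
"Proposition 124", Prop. 7.2.3 = "Proposition 147", Cor. 7.2.4 = "Corollary 148",
the §7.1 definition of "automorphic" is on p. 100 and the weight definition of §2.3.1 on p. 19.

## What the source prints (quoted from the held copy)

* **Thm. 1.0.1** (Introduction): *Let `E` be an elliptic curve over a CM number field `F`. Then
  `E` and all the symmetric powers of `E` are potentially modular. Consequently, the Sato–Tate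
  conjecture holds for `E`.* — "a special case of Corollaries 7.1.13 and 7.1.14".
* **§2.3.1**: *If `π` is an irreducible admissible representation of `GL_n(𝔸_F)` and
  `λ ∈ (ℤⁿ_+)^{Hom(F, ℂ)}`, we say that `π` is of weight `λ` if the infinitesimal character of
  `π_∞` is the same as that of `V_λ^∨`.* (Weight `0`: the infinitesimal character of the trivial
  representation — the tree's `AutomorphicRepData.HasWeightZero`, Clozel 1990 §3.5.)
* **§7.1** (p. 100 of the held copy): *The very weakly compatible system `R` is defined to be
  automorphic if there is a regular algebraic, cuspidal automorphic representation `π` of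
  `GL_n(𝔸_F)` and an embedding `ı : M ↪ ℂ`, such that if `v ∉ S`, then `π_v` is unramified and
  `rec(π_v |det|_v^{(1-n)/2})(Frob_v)` has characteristic polynomial `ı(Q_v(X))`.*
* **Cor. 7.1.12** (the "simpler immediate consequence" of the main Thm. 7.1.11): *Suppose that
  `F` is a CM field and that the 5-tuple `R = (M, S, {Q_v(X)}, {r_λ}, {{0,1}})` is a strongly
  irreducible rank `2` very weakly compatible system of `l`-adic representations of `G_F`. If `m`
  is a non-negative integer, then there exists a finite Galois CM extension `F'/F` such that the
  weakly compatible system `Symm^m R|_{G_{F'}}` is automorphic.*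
* **Weight zero is printed in the proof, not in Cor. 7.1.12**: the automorphy lifting theorems
  conclude *"`ρ` is automorphic: there exists a cuspidal automorphic representation `Π` of
  `GL_n(𝔸_F)` of weight `λ` such that `ρ ≅ r_ι(Π)`"* (Thm. 6.1.1) and *"`ρ` is ordinarily
  automorphic of weight `ιλ`"* (Thm. 6.1.2), and the proof of Thm. 7.1.11 (§7.2, last page)
  ends with *"regular algebraic, cuspidal automorphic representations `π_i''` of
  `GL_{1+m_i}(𝔸_{F'})` unramified above `𝓛` and of weight `(0)_{τ,i}`, and `ı : ℚ̄_{l₂} ≅ ℂ` such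
  that `Symm^{m_i} r'_{i,λ_i}|_{G_{F'}} ≅ r_{l₂,ı}(π_i'')`. Untwisting completes the proof"*
  (`r'_i = R_i|_{G_{FF₁⁺}} ⊗ φ_i⁻¹` with `φ_i` of finite order, so the untwisted representation
  still has weight `0`); likewise Cor. 7.2.4 (*"of weight `(0)_{τ,i}` … `Symm^m r_{E,l}|^∨_{G_{F'}}
  ≅ r_{l,ı}(π)`"*). For `m = 1` and `H_τ = {0,1}` the weight `λ` of Thms. 6.1.1/6.1.2 is `0`.
* The source applies this to the system of an elliptic curve,
  `R_E = (ℚ, S_E, {X² - a_v X + q_v}, {r_{E,l}}, {{0,1}})` (`r_{E,l} = H¹_ét(E_{F̄}, ℚ̄_l) = V_l(E)^∨`,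
  `a_v = q_v + 1 - #Ẽ(k_v)`, `S_E` the places of bad reduction), which for `E` without (geometric)
  CM is strongly irreducible — this is how Thm. 1.0.1 and Cor. 7.1.14 (Sato–Tate for non-CM `E`)
  are read off Cor. 7.1.12–7.1.13; and `R_E|_{G_{F'}} = R_{E ×_F F'}`.
* Proof architecture of Thm. 7.1.11 (§7.2, recorded for tenure; none of it has a Lean carrier):
  auxiliary non-CM `E₀/ℚ` and primes `l₁, l₂` (Assumption 7.2.6); Grunwald–Wang; moduli of
  elliptic curves with prescribed `l₁`- and `l₂`-torsion and the theorem of Moret-Bailly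
  ([BLGGT] Prop. 3.1.1) for CM points; potential automorphy of `Symm^m` of a non-CM `E₀/ℚ` over
  totally real fields (Prop. 7.2.3, the [BLGGT14] variant; Cor. 7.2.4); the automorphy lifting
  Theorem 6.1.1 applied at `l₁` and again at `l₂` (residual conditions from Lemmas 7.1.5–7.1.8),
  itself resting on the Galois representations attached to torsion classes (Scholze) with
  local–global compatibility (§§3–5, Caraiani–Scholze) and derived Ihara avoidance (§6); soluble
  base change (Prop. 6.5.13). Their hypotheses (crystalline / Fontaine–Laffaille and ordinary
  conditions at `v ∣ p`, Hodge–Tate weights labelled by embeddings, decomposed-generic and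
  enormous residual images, Hecke algebras `𝕋^S(K, λ)` on `H^*(X_K, 𝒱_λ)`) have no carrier in
  Mathlib or `Literature` (G09 `PAdicHodge` exposes only unlabelled Hodge–Tate multisets), so —
  as for the sibling `Sweep1PotentialModularity` — no printed result below Cor. 7.1.12 can be
  vendored faithfully today: Cor. 7.1.12 for `R_E` (with the weight read off the proof) is the
  honest unit of debt, and `potentiallyModular_ellipticCurve_CM_holds` cannot be assembled from
  Mathlib/Literature (triage XL).

## Contents

* `Literature.NumberTheory.Automorphic.IsAutomorphicOfWeightZero E` (**definition**), for an
  integral Weierstrass model `E` over `𝓞 L`: the §7.1 condition "`R_E` is automorphic" by a `π` **of weight `0`**, read at the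
  finite places `w ∤ Δ(E)` of good reduction of the model (a subset of the printed `w ∉ S_E`) on
  the objects of `ReciprocityGLn`/`AutomorphicRepsGL`: there are
  `hL : isCompact_glFiniteIntegralLevel 2 L` (a true Prop needed to type `π`, as in the target)
  and a cuspidal automorphic representation datum `π` of `GL₂(𝔸_L)` with `π.1.HasWeightZero` such
  that for every `w` with `Δ(E) ∉ w`, `π` has Hecke polynomial `X² - a_w X + q_w` at `w`
  (`AutomorphicRepData.HasHeckePolynomialAt`, i.e. `π_w` is unramified with Satake parameter
  `{α₁, α₂}` and `(X - q_w^{1/2} α₁)(X - q_w^{1/2} α₂) = X² - a_w X + q_w`; `a_w = frobTraceAt E w`,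
  `frobPoly` of the sibling file). API: `IsAutomorphicOfWeightZero.eventually_hasSatakeParamAt`.
* **Proved** (everything in this file): `eventually_not_mem_asIdeal` (a non-zero integer of
  `L` lies in finitely many `w`); `exists_hasSatakeParamAt_of_hasHeckePolynomialAt_frobPoly` (a
  Hecke polynomial `X² - a X + q_w` forces `q_w^{1/2}(α₁ + α₂) = a` and `q_w α₁ α₂ = q_w` for the
  Satake parameter); `IsAutomorphicOfWeightZero.eventually_hasSatakeParamAt`;
  `baseChange_ringOfIntegers_Δ_ne_zero`; the **pointwise reduction**
  `exists_isCMField_hasWeightZero_of_isAutomorphicOfWeightZero` (if `E ⊗ 𝓞 L` is automorphic of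
  weight zero for some CM field `L ⊇ K`, then the conclusion of
  `potentiallyModular_ellipticCurve_CM` holds for `E / 𝓞 K`); and the **global reduction**
  `potentiallyModular_ellipticCurve_CM_of_isAutomorphicOfWeightZero`, whose explicit hypothesis is
  the printed Cor. 7.1.12 for `m = 1` and `R = R_E` read in weight `0` (for a CM number field `K`
  and an integral model `E / 𝓞 K` with `Δ ≠ 0` of an elliptic curve without geometric CM there is
  a finite extension `L / K` with `L` a CM field and `IsAutomorphicOfWeightZero (E ⊗ 𝓞 L)`; the
  printed "Galois" is not needed for the reduction and is dropped from the hypothesis).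

So the accepted `Literature.NumberTheory.Automorphic.potentiallyModular_ellipticCurve_CM` is
implied by — and is the tree's single unit of debt for — the source's Cor. 7.1.12 for `R_E` read
in weight `0`, whose proof is the whole of the source ("Proof architecture" above; triage XL, no
carriers: in particular it is *not* reducible to lang.S27 `exists_galoisRep_of_regularAlgebraic`
— Galois representations of characteristic-`0` regular algebraic cuspidal `π` are one input of
§7 among many, while the automorphy lifting Theorems 6.1.1/6.1.2 rest on Galois representations
attached to *torsion* classes with local–global compatibility, §§2–5). Unlike the `Sweep1`
formulation no Tate-module input is needed for the reduction, because the target reads `a_w` off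
the reduction of the given integral model (`frobTraceAt`), which is what `Q_w(X) = X² - a_w X + q_w`
of `R_{E_L}` is at a place of good reduction of the model (any integral model with `w ∤ Δ` is
minimal at `w`, Silverman VII.1.3 and Rem. VII.1.1, so its reduction is `Ẽ_w`).

## Normalisations (why `IsAutomorphicOfWeightZero` reads the printed condition; cf. the sibling)

By §1 of the source (`Frob_v` geometric, `Art_K` sends uniformizers to geometric Frobenii,
`rec` the local Langlands correspondence of Harris–Taylor), an unramified `π_w ↪ π(χ₁, χ₂)`
(unitary induction) has `rec(π_w)(Frob_w) ∼ diag(α₁, α₂)`, `α_i = χ_i(ϖ_w)`, so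
`rec(π_w |det|_w^{-1/2})(Frob_w)` has eigenvalues `q_w^{1/2} α_i`; and `{α₁, α₂}` is the multiset of
the tree's `HasSatakeParamAt` (eigenvalues `q_w^{i(n-i)/2} e_i(α)` of `T_{w,i}`; Bump Prop. 4.6.6:
`T(𝔭) ↦ q^{1/2}(α₁ + α₂)`, `R(𝔭) ↦ α₁ α₂`). The tree's `HasHeckePolynomialAt w P` is by definition
`P = ∏ (X - q_w^{(n-1)/2} α_j)` for a Satake parameter `α` (the Clozel / Harris–Lan–Taylor–Thorne
polynomial), so "`rec(π_w |det|_w^{-1/2})(Frob_w)` has characteristic polynomial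
`Q_w(X) = X² - a_w X + q_w`" is literally `HasHeckePolynomialAt w (X² - a_w X + q_w)`; it gives
`q_w^{1/2}(α₁ + α₂) = a_w` (the target's identity) and `α₁ α₂ = 1`.
*Weaker than the source, never stronger*: only the places `w ∤ Δ(E ⊗ 𝓞 L)` (all of good
reduction for `E_L`, hence outside `S_{E_L}`) are constrained; "finite Galois CM extension" is
kept (`IsGalois K L`, `IsCMField L`); weight `0` is asserted on the strength of the proof of
Thm. 7.1.11 and of Thms. 6.1.1/6.1.2 as printed (see above) — Cor. 7.1.12 alone prints "regular
algebraic". Geometric CM is excluded (`¬ (E.baseChange K).HasCM`, prelude `Isogeny`), exactly the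
hypothesis of the target (for CM `E` the weight-`0` *cuspidal* conclusion fails over `L ⊇ K M`).

## Design notes

* The two accepted formulations of lang.S28 now have parallel decomposition files: the sibling's
  `WeierstrassCurve.IsTateAutomorphic` lives on G19's `L²` objects (`CuspidalAutomorphicRepGL`,
  one level `K(𝔫)`, plus the Galois half on `V_ℓ E`) and carries no infinity type; the present
  `IsAutomorphicOfWeightZero` lives on Borel–Jacquet data (`CuspidalAutomorphicRepData`) and
  carries `HasWeightZero`. Neither implies the other inside the tree (the dictionary between the
  two languages is the pair of named facts `exists_isAssociatedL2` / `hasSatakeParamAt_iff_L2` of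
  `AutomorphicRepsGL`, and weight `0` has no `L²` carrier); both files cite Cor. 7.1.12, but only
  the sibling still carries it as a named fact (`exists_isCMField_isTateAutomorphic`); here it is
  the hypothesis of a proved reduction.
* `frobPoly a q = X² - a X + q ∈ ℤ[X]`, `coeff_quadratic_eq`, `X_sub_C_mul_X_sub_C` are reused from
  `Sweep1PotentialModularity` (same namespace `Literature.NumberTheory.Automorphic`).
* `hL : isCompact_glFiniteIntegralLevel 2 L` is existentially quantified inside the definition,
  as in the target (`GLnAdelicStructure`; a true Prop, D-0014 threading of `AutomorphicRepsGL`).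
* Universe: number fields in `Type`, as the target and `CuspidalAutomorphicRepData` require.
* Mathlib (grepped): `Ideal.finite_factors`, `Ideal.dvd_span_singleton`,
  `NumberField.RingOfIntegers.algebraMap.injective`, `WeierstrassCurve.map_Δ`,
  `Multiset.card_eq_two`, `NumberField.IsCMField`, `IsGalois`. No new instances; no `sorry`.

## References

* P. B. Allen, F. Calegari, A. Caraiani, T. Gee, D. Helm, B. V. Le Hung, J. Newton, P. Scholze,
  R. Taylor, J. A. Thorne, *Potential automorphy over CM fields*, Ann. of Math. (2) 197 (2023),
  897–1113 (held: `lit:arxiv-1812.09999`): Thm. 1.0.1, §2.3.1 (weight), §7.1 (very weakly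
  compatible systems; "automorphic"), Thm. 7.1.11, Cor. 7.1.12–7.1.14, Thms. 6.1.1–6.1.2, §7.2
  (Cor. 7.2.4, proof of Thm. 7.1.11). [ACCGHLNSTT2023]
* D. Bump, *Automorphic Forms and Representations* (1997), Prop. 4.6.6; L. Clozel, *Motifs et
  formes automorphes* (1990), §3.3–3.5 and Conj. 4.5. [Clozel1990]
* J. H. Silverman, *The Arithmetic of Elliptic Curves*, 2nd ed. (2009), Thm. V.2.3.1, VII.1.1,
  VII.1.3, C.§16. [SilvermanAEC2009]
-/

open scoped MatrixGroups Matrix Classical Polynomial NumberField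
open NumberField IsDedekindDomain Polynomial Filter Literature.NumberTheory.Automorphic

noncomputable section

namespace Literature.NumberTheory.Automorphic

/-! ### A non-zero integer lies in only finitely many finite places -/

section Places

/-- For a non-zero `x ∈ 𝓞 L`, all but finitely many finite places `w` of the number field `L`
satisfy `x ∉ w` (the primes containing `x` are the finitely many prime factors of the non-zero
ideal `(x)`, Mathlib `Ideal.finite_factors`); pattern of `eventually_natCast_not_mem_asIdeal` of
the sibling file. [folklore] -/
theorem eventually_not_mem_asIdeal {L : Type*} [Field L] [NumberField L] {x : 𝓞 L}
    (hx : x ≠ 0) : ∀ᶠ w : HeightOneSpectrum (𝓞 L) in cofinite, x ∉ w.asIdeal := by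
  have hne : Ideal.span {x} ≠ ⊥ := by
    rwa [Ne, Ideal.span_singleton_eq_bot]
  refine Filter.mem_of_superset (Ideal.finite_factors hne).compl_mem_cofinite ?_
  intro w hw hmem
  exact hw (Ideal.dvd_span_singleton.2 hmem)

end Places

/-! ### Hecke polynomial `X² - a X + q_w` and the Satake parameter -/

section HeckePolynomial

variable {L : Type} [Field L] [NumberField L] {hL : isCompact_glFiniteIntegralLevel 2 L}

/-- **Reading a quadratic Hecke polynomial.** If the automorphic representation `π` of
`GL₂(𝔸_L)` has Hecke polynomial `X² - a X + q_w` at `w` (`HasHeckePolynomialAt`: for a Satake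
parameter `α` of `π` at `w`, `∏_{z ∈ α} (X - q_w^{1/2} z) = X² - a X + q_w`), then `α = {α₁, α₂}`
with `q_w^{1/2}(α₁ + α₂) = a` and `(q_w^{1/2} α₁)(q_w^{1/2} α₂) = q_w` (compare coefficients; the
`T_w`-eigenvalue `q_w^{1/2} e₁(α)` is `a`, Bump Prop. 4.6.6, and the central character is trivial at
`ϖ_w`); cf. Clozel 1990, §3.3 (the Hecke polynomial at an unramified place). Elementary
comparison of coefficients. [folklore] -/
theorem exists_hasSatakeParamAt_of_hasHeckePolynomialAt_frobPoly
    {π : AutomorphicRepData (AutomorphyDatum.gl 2 L hL)} {w : HeightOneSpectrum (𝓞 L)} {a : ℤ}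
    (h : π.HasHeckePolynomialAt w ((frobPoly a w.residueCard).map (Int.castRingHom ℂ))) :
    ∃ α : Multiset ℂ, π.HasSatakeParamAt w α ∧
      ((Real.sqrt w.residueCard : ℝ) : ℂ) * α.sum = (a : ℂ) ∧
      ((Real.sqrt w.residueCard : ℝ) : ℂ) ^ 2 * α.prod = (w.residueCard : ℂ) := by
  obtain ⟨α, hα, hP⟩ := h
  refine ⟨α, hα, ?_⟩
  obtain ⟨z₁, z₂, rfl⟩ := Multiset.card_eq_two.1 hα.card_eq
  set c : ℂ := ((Real.sqrt (w.residueCard : ℝ) : ℝ) : ℂ) with hc_def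
  have hpoly : (X : ℂ[X]) ^ 2 - Polynomial.C (a : ℂ) * X + Polynomial.C ((w.residueCard : ℕ) : ℂ) =
      X ^ 2 - Polynomial.C (c * z₁ + c * z₂) * X + Polynomial.C (c * z₁ * (c * z₂)) := by
    rw [← X_sub_C_mul_X_sub_C]
    simpa [frobPoly, satakePolynomial, Polynomial.map_sub, Polynomial.map_add,
      Polynomial.map_mul, Polynomial.map_pow, hc_def] using hP
  obtain ⟨hsum, hprod⟩ := coeff_quadratic_eq hpoly
  constructor
  · rw [Multiset.insert_eq_cons, Multiset.sum_cons, Multiset.sum_singleton, mul_add, ← hsum]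
  · rw [Multiset.insert_eq_cons, Multiset.prod_cons, Multiset.prod_singleton, hprod]
    ring

end HeckePolynomial

/-! ### `R_E` automorphic of weight zero (source §7.1, weight from §7.2) -/

section WeightZero

variable {L : Type} [Field L] [NumberField L]

/-- **The integral model `E / 𝓞 L` is automorphic of weight zero**: the compatible system
`R_E = (ℚ, S_E, {X² - a_w X + q_w}, {H¹_ét(E_{L̄}, ℚ̄_l)}, {{0,1}})` of the elliptic curve `E_L`
*is automorphic* in the sense of Allen et al., §7.1 — *"there is a regular algebraic, cuspidal
automorphic representation `π` of `GL_n(𝔸_F)` and an embedding `ı : M ↪ ℂ`, such that if `v ∉ S`,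
then `π_v` is unramified and `rec(π_v |det|_v^{(1-n)/2})(Frob_v)` has characteristic polynomial
`ı(Q_v(X))`"* — by a `π` **of weight `0`** (§2.3.1: `π_∞` has the infinitesimal character of the
trivial representation; the weight produced by Thms. 6.1.1/6.1.2 and the proof of Thm. 7.1.11 for
Hodge–Tate numbers `{0,1}`), read on the Borel–Jacquet data of `AutomorphicRepsGL` at the places
`w ∤ Δ(E)` of good reduction of the model (a subset of `w ∉ S_E`; there `Q_w = X² - a_w X + q_w`
with `a_w = q_w + 1 - #E(k_w) = frobTraceAt E w`): there are `hL` (the compactness Prop needed to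
type `π`, `GLnAdelicStructure`) and a cuspidal automorphic representation datum `π` of `GL₂(𝔸_L)`
(`CuspidalAutomorphicRepData 2 L hL`) of weight zero (`HasWeightZero`) such that at every finite
place `w` with `Δ(E) ∉ w`, `π` has Hecke polynomial `X² - a_w X + q_w`
(`AutomorphicRepData.HasHeckePolynomialAt`: `π_w` unramified with Satake parameter `{α₁, α₂}` and
`(X - q_w^{1/2} α₁)(X - q_w^{1/2} α₂) = X² - a_w X + q_w`, the characteristic polynomial of
`rec(π_w |det|_w^{-1/2})(Frob_w)`; module docstring, "Normalisations"). For a model with `Δ = 0`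
no place is constrained and the notion is junk (it only asserts that some weight-zero cuspidal `π`
exists); the reduction theorems below and the target assume `Δ ≠ 0`.
[cite: ACCGHLNSTT2023, §7.1 (definition of an automorphic compatible system, for R = R_E) and §2.3.1 (weight)] -/
def IsAutomorphicOfWeightZero (E : WeierstrassCurve (𝓞 L)) : Prop :=
  ∃ (hL : isCompact_glFiniteIntegralLevel 2 L) (π : CuspidalAutomorphicRepData 2 L hL),
    π.1.HasWeightZero ∧
      ∀ w : HeightOneSpectrum (𝓞 L), E.Δ ∉ w.asIdeal →
        π.1.HasHeckePolynomialAt w ((frobPoly (frobTraceAt E w) w.residueCard).map (Int.castRingHom ℂ))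

/-- **From Hecke polynomials to the target's trace identity, at almost all places.** If the
model `E / 𝓞 L` with `Δ(E) ≠ 0` is automorphic of weight zero by `π`, then at all but finitely many
finite places `w` (namely `w ∤ Δ(E)`, `eventually_not_mem_asIdeal`) `π` is unramified with a Satake
parameter `α` satisfying `q_w^{1/2} ∑ α = a_w(E)` (and `q_w ∏ α = q_w`): the shape of the
conclusion of `Literature.NumberTheory.Automorphic.potentiallyModular_ellipticCurve_CM`. Clozel 1990, §3.3; source §7.1.
[cite: ACCGHLNSTT2023, §7.1] -/
theorem IsAutomorphicOfWeightZero.eventually_hasSatakeParamAt {E : WeierstrassCurve (𝓞 L)}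
    (hE : IsAutomorphicOfWeightZero E) (hΔ : E.Δ ≠ 0) :
    ∃ (hL : isCompact_glFiniteIntegralLevel 2 L) (π : CuspidalAutomorphicRepData 2 L hL),
      π.1.HasWeightZero ∧
        ∀ᶠ w : HeightOneSpectrum (𝓞 L) in cofinite, ∃ α : Multiset ℂ,
          π.1.HasSatakeParamAt w α ∧
            ((Real.sqrt w.residueCard : ℝ) : ℂ) * α.sum = (frobTraceAt E w : ℂ) := by
  obtain ⟨hL, π, h0, hH⟩ := hE
  refine ⟨hL, π, h0, ?_⟩
  filter_upwards [eventually_not_mem_asIdeal hΔ] with w hw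
  obtain ⟨α, hα, hsum, -⟩ := exists_hasSatakeParamAt_of_hasHeckePolynomialAt_frobPoly (hH w hw)
  exact ⟨α, hα, hsum⟩

/-- The discriminant of the base change `E ⊗ 𝓞 L` of an integral model with `Δ ≠ 0` along a
number-field extension `L/K` is non-zero (`WeierstrassCurve.map_Δ` and injectivity of
`𝓞 K → 𝓞 L`, Mathlib `NumberField.RingOfIntegers.algebraMap.injective`). [folklore] -/
theorem baseChange_ringOfIntegers_Δ_ne_zero {K : Type} [Field K] [NumberField K]
    (L : Type) [Field L] [NumberField L] [Algebra K L] {E : WeierstrassCurve (𝓞 K)}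
    (hΔ : E.Δ ≠ 0) : (E.baseChange (𝓞 L)).Δ ≠ 0 := by
  rw [WeierstrassCurve.baseChange, WeierstrassCurve.map_Δ]
  exact (map_ne_zero_iff _ (RingOfIntegers.algebraMap.injective K L)).2 hΔ

/-- **Pointwise reduction of lang.S28 to the printed §7.1 condition.** Let `E / 𝓞 K` be an integral
model with `Δ(E) ≠ 0` and `L ⊇ K` a CM number field over which the base-changed model `E ⊗ 𝓞 L` is
automorphic of weight zero (`IsAutomorphicOfWeightZero`: the compatible system `R_{E_L}` is
automorphic in the sense of the source, §7.1, by a weight-`0` cuspidal `π` of `GL₂(𝔸_L)`). Then the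
conclusion of `Literature.NumberTheory.Automorphic.potentiallyModular_ellipticCurve_CM` holds for
`E`: the same `L` and `π`, and at the cofinitely many places `w ∤ Δ(E ⊗ 𝓞 L)`
(`baseChange_ringOfIntegers_Δ_ne_zero`, `eventually_not_mem_asIdeal`) the Hecke polynomial
`X² - a_w X + q_w` yields a Satake parameter `α` with `q_w^{1/2} ∑ α = a_w(E_L)`
(`IsAutomorphicOfWeightZero.eventually_hasSatakeParamAt`). This is the one-line closing step for
any future proof of automorphy of `E` over a CM extension; source §7.1 (definition of an
automorphic compatible system) and Cor. 7.1.12–7.1.13 (how Thm. 1.0.1 is read off).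
[cite: ACCGHLNSTT2023, §7.1 and Cor. 7.1.12 (m = 1, R = R_E)] -/
theorem exists_isCMField_hasWeightZero_of_isAutomorphicOfWeightZero {K : Type} [Field K]
    [NumberField K] {E : WeierstrassCurve (𝓞 K)} (hΔ : E.Δ ≠ 0) (L : Type) [Field L]
    [NumberField L] [Algebra K L] [hCM : IsCMField L]
    (hA : IsAutomorphicOfWeightZero (E.baseChange (𝓞 L))) :
    ∃ (L' : Type) (_ : Field L') (_ : NumberField L') (_ : Algebra K L') (_ : IsCMField L')
      (hL' : isCompact_glFiniteIntegralLevel 2 L'),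
      ∃ π : CuspidalAutomorphicRepData 2 L' hL', π.1.HasWeightZero ∧
        ∀ᶠ w : HeightOneSpectrum (𝓞 L') in cofinite, ∃ α : Multiset ℂ,
          π.1.HasSatakeParamAt w α ∧
            ((Real.sqrt w.residueCard : ℝ) : ℂ) * α.sum =
              (frobTraceAt (E.baseChange (𝓞 L')) w : ℂ) := by
  obtain ⟨hL, π, h0, hev⟩ :=
    hA.eventually_hasSatakeParamAt (baseChange_ringOfIntegers_Δ_ne_zero L hΔ)
  exact ⟨L, _, _, _, hCM, hL, π, h0, hev⟩

/-- **lang.S28 (`ReciprocityGLn` formulation) from the printed statement.** The printed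
Cor. 7.1.12 of Allen–Calegari–Caraiani–Gee–Helm–Le Hung–Newton–Scholze–Taylor–Thorne (*Suppose that
`F` is a CM field and that `R = (M, S, {Q_v(X)}, {r_λ}, {{0,1}})` is a strongly irreducible rank `2`
very weakly compatible system of `l`-adic representations of `G_F`. If `m` is a non-negative
integer, then there exists a finite Galois CM extension `F'/F` such that the weakly compatible
system `Symm^m R|_{G_{F'}}` is automorphic*), for `m = 1` and the system `R_E` of an elliptic curve
without geometric CM over a CM field `K` (strongly irreducible; `R_E|_{G_L} = R_{E_L}`), with the
weight `(0)_{τ,i}` of the automorphic representations read off the proof of Thm. 7.1.11 (§7.2;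
Thms. 6.1.1/6.1.2) — taken here as the explicit **hypothesis** `h`, on the objects of the tree:
for every CM number field `K` and integral model `E / 𝓞 K` with `Δ ≠ 0` and `¬ (E ⊗ K).HasCM` there
is a finite extension `L / K` with `L` a CM field such that `E ⊗ 𝓞 L` is automorphic of weight zero
(`IsAutomorphicOfWeightZero`; the printed "Galois" is not needed and not assumed) — implies the
accepted formulation `Literature.NumberTheory.Automorphic.potentiallyModular_ellipticCurve_CM` of
lang.S28 (pointwise: `exists_isCMField_hasWeightZero_of_isAutomorphicOfWeightZero`). The hypothesis
is the statement of the former named fact `exists_isCMField_isAutomorphicOfWeightZero` of this file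
(minus `IsGalois K L`), merged back into the obligation `potentiallyModular_ellipticCurve_CM` by the
review of 2026-08-15 (D-0026: a decomposition child must not carry the whole parent); its proof is
the whole of the source (module docstring, "Proof architecture") and is *not* supplied here — this
theorem only exhibits that the tree's paraphrase is no stronger than the printed theorem so read.
[cite: ACCGHLNSTT2023, Thm. 1.0.1 (non-CM case), via Cor. 7.1.12 and §7.1] -/
theorem potentiallyModular_ellipticCurve_CM_of_isAutomorphicOfWeightZero
    (h : ∀ {K : Type} [Field K] [NumberField K] [IsCMField K] (E : WeierstrassCurve (𝓞 K)),
      E.Δ ≠ 0 → ¬ (E.baseChange K).HasCM →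
        ∃ (L : Type) (_ : Field L) (_ : NumberField L) (_ : Algebra K L),
          IsCMField L ∧ IsAutomorphicOfWeightZero (E.baseChange (𝓞 L))) :
    potentiallyModular_ellipticCurve_CM := by
  intro K _ _ _ E hΔ hCM
  obtain ⟨L, _, _, _, hCML, hA⟩ := h E hΔ hCM
  exact exists_isCMField_hasWeightZero_of_isAutomorphicOfWeightZero (hCM := hCML) hΔ L hA

end WeightZero

end Literature.NumberTheory.Automorphic
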